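import Summits.ABC.IUTFork.Thm311RealGaloisLogAnalytic
import Literature.IUT.LogVolume.GenuineLogThetaPerImageSubIndeterminacy
import Literature.IUT.LogVolume.GenuineLogThetaUnionSubIndeterminacy
import HarnessLib

/-!
# PRINT's (Ind2) on a GENUINE tensor packet is the group of unit homotheties `ℤ_p^×·id` — hence readings (P) and (U) of the
# cell's `−|log(Θ)|` computed over print's factorwise `Ism` carry ZERO (Ind2)-gain
# ([IUTchIII] Thm. 3.11 (i) (Ind2), Cor. 3.12 Step (x); [IUTchII] Ex. 1.8 (iv); Dupuy–Hilado §4.9, §4.12)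

PROOF-ONLY file (D-0012; no definition, no `Prop` fact) of the abc-iut cell (WAVE-3 discharge seat abc-iut-c312-d1, gen 11; row
«C:PERIMAGE-PRINT-ISM», the JOIN of two typed worlds of the cell). TAKES NO SIDE on [IUTchIII] Cor. 3.12.

THE TWO WORLDS. (A) abc-iut-c312-1 typed PRINT's `Ism(G_v)` for the GENUINE MLF pair at a finite place `v` of a number field —
`Real.ismGenuine v := isometryGroup (galRho v) (openSubgroups v)` ([IUTchII] Ex. 1.8 (iv), kurims p. 39: «`G`-equivariant automorphisms
of … `O^{×μ}(G)` that, for each open subgroup `H ⊆ G`, preserve the lattice … determined by the image of `O^×(G)^H`») — and its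
realisation on `K_v` through the logarithm, `Real.ismIsm logv v`; abc-iut-w5-d216 COMPUTED it: `Real.ismIsm_analyticLogv_eq_unitScalars`
(p452975) — through the (analytic = Galois) `p_v`-adic logarithm, print's (Ind2)-group at `v` is EXACTLY `{a ↦ c·a : c ∈ ℚ_p, ‖c‖ = 1}`
(norm rigidity + the tree's discharged local existence theorem + Hensel; unconditional). (B) this lineage's L-DH genuine world: the real
prime packets `realPrimePacketWith p (σ.localFields p) c` of the GENUINE completions `K_{v̲} = RescaledCompletion K p v̲` of a place section
`σ` (abc-iut-c312-3 / abc-iut-S7), on which gen 10 proved (p503117 / p503854) that `−|log(Θ)|` in readings (P) and (U) is MONOTONE in the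
(Ind2)-subgroup and carries ZERO gain over any family of UNIT HOMOTHETIES. The carriers coincide (`PlaceSection.localFields_k`, `rfl`).

THIS FILE joins them:
* `eq_prod_smul_of_map_tprod` / `exists_unit_smul_of_map_tprod` — multilinearity: a `ℚ_p`-linear map of `⊗_{ℚ_p} k_i` acting on pure tensors
  factorwise by scalars `c_i` IS the homothety `Π c_i` (and `‖Π c_i‖ = 1` for units);
* **`exists_unit_smul_of_printInd2`** — on `X = ⊗_b K_{w_b}` (genuine completions), an automorphism acting on pure tensors through «independent
  copies of Ism … on each of the direct summands of the j+1 factors» ([IUTchIII] Thm. 3.11 (i) (Ind2), p. 154 l. 55–64) — factorwise elements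
  `ψ_b ∈ Real.ismIsm (analyticLogv K) w_b` — is `u·id`, `‖u‖ = 1`; **`exists_printInd2_of_unit`** — conversely every unit homothety arises:
  PRINT's factorwise (Ind2) on a genuine packet, AS TYPED, is EXACTLY `ℤ_p^×·id` (inside the Dupuy–Hilado container, gen 10's
  `smulOfUnit_mem_indTwo`);
* `forall_exists_unit_smul_of_printInd2`, **`localFields_lnνLp_hull_printInd2_eq_pilotRegion`**, **`localFields_lnνLp_hull_printInd2_slotUnion_eq`** —
  for the genuine packet of a place section (any shell normalisation) and ANY family `H` of subgroups of the packet automorphisms DOMINATED BY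
  PRINT's (Ind2): reading (P) over `H` = the bare `ln ν̄_{𝕃_p}(O_𝕃(−P_Θ)_p)`; reading (U) over `H` = the pure (Ind1)-value.
The input/datum-level consequence (the per-image inequality over print's (Ind2) FAILS at every genuine datum with `l ≥ 5`,
`log q^{∤2l}(λ) ≥ 24`) is the sequel `LDHGenuinePerImagePrintIsm.lean`.

HONEST WORDS (about OUR typings): print's `Ism` is read as c312-1 typed it (abc-iut-L6-t2's `isometryGroup`, topologies suppressed; realised on
`K_v` through THE logarithm); whether print's EFFECTIVE indeterminacy at `v ∈ 𝕍^bad` is this factorwise `Ism` or acts before the log /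
tensor passage is referee finding F-B28-1's reading matter; (Ind1), (Ind3), the log-link and Cor. 3.12 itself are untouched; nothing here
asserts that abc is proved or refuted; no side taken. [cite: Mochizuki2012, IUTchIII Thm. 3.11 (i) p. 154; Cor. 3.12 proof Step (x) p. 181]
[cite: Mochizuki2012, IUTchII Ex. 1.8 (iv) p. 39] [cite: DupuyHilado2025, §4.7, §4.9, §4.12, Thm. 3.10.1] [claim: Mochizuki2012, status: disputed]
for every IUT quotation. Axioms: standard three.
-/

noncomputable section

open Set Module NumberField IsDedekindDomain
open scoped Pointwise TensorProduct

/-! ## 1. Tensor algebra: a factorwise family of scalars acts on `⊗_{ℚ_p} k_i` as ONE scalar -/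

namespace Literature.IUT.LogVolume

section FactorwiseScalars

variable (p : ℕ) [Fact p.Prime] {I : Type} [Fintype I]
variable (k : I → Type) [∀ i, NontriviallyNormedField (k i)] [∀ i, NormedAlgebra ℚ_[p] (k i)]

/-- **Multilinearity**: a `ℚ_p`-linear endomorphism `g` of the packet `V = ⊗_{ℚ_p, i} k_i` that acts on every pure tensor
FACTORWISE by scalars, `g(⊗_i x_i) = ⊗_i (c_i·x_i)`, IS the homothety `x ↦ (Π_i c_i)·x` on all of `V` (pure tensors span).
[folklore] -/
theorem eq_prod_smul_of_map_tprod (g : PacketAlgebra p k →ₗ[ℚ_[p]] PacketAlgebra p k) (c : I → ℚ_[p])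
    (hg : ∀ x : Π i, k i, g (PiTensorProduct.tprod ℚ_[p] x) = PiTensorProduct.tprod ℚ_[p] (fun i => c i • x i))
    (y : PacketAlgebra p k) : g y = (∏ i, c i) • y := by
  have h : g = (∏ i, c i) • LinearMap.id := by
    refine PiTensorProduct.ext ?_
    ext x
    simp only [LinearMap.compMultilinearMap_apply, LinearMap.smul_apply, LinearMap.id_apply, hg]
    exact (PiTensorProduct.tprod ℚ_[p]).map_smul_univ c x
  rw [h]
  rfl

/-- The product of `p`-adic units is a `p`-adic unit: `‖c_i‖ = 1` for all `i` gives `‖Π_i c_i‖ = 1`. [folklore] -/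
theorem norm_prod_eq_one_of_forall {c : I → ℚ_[p]} (hc : ∀ i, ‖c i‖ = 1) : ‖∏ i, c i‖ = 1 := by
  rw [norm_prod]
  exact Finset.prod_eq_one fun i _ => hc i

/-- Hence: a `ℚ_p`-linear automorphism acting on pure tensors factorwise by UNIT scalars is a UNIT HOMOTHETY `u·id`,
`‖u‖ = 1` — the hypothesis form of this lineage's zero-gain theorems (`TensorPacketOrbitStable`,
`GenuineLogThetaPerImageSubIndeterminacy`). [folklore] -/
theorem exists_unit_smul_of_map_tprod (g : PacketAlgebra p k ≃ₗ[ℚ_[p]] PacketAlgebra p k) (c : I → ℚ_[p])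
    (hc : ∀ i, ‖c i‖ = 1)
    (hg : ∀ x : Π i, k i, g (PiTensorProduct.tprod ℚ_[p] x) = PiTensorProduct.tprod ℚ_[p] (fun i => c i • x i)) :
    ∃ u : ℚ_[p], ‖u‖ = 1 ∧ ∀ y, g y = u • y :=
  ⟨∏ i, c i, norm_prod_eq_one_of_forall p hc, eq_prod_smul_of_map_tprod p k g.toLinearMap c hg⟩

end FactorwiseScalars

end Literature.IUT.LogVolume

/-! ## 2. PRINT's (Ind2) at the factors of a genuine tensor packet: factorwise `Ism(G_{v̲_b})`-families are unit homotheties -/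

namespace Summit.ABC.IUTFork

open Literature.IUT.LogVolume Literature.NumberTheory.NumberFields Thm311.Real

section PrintFactors

variable {K : Type} [Field K] [NumberField K] (p : ℕ) [hp : Fact p.Prime]
variable {I : Type} [Fintype I] (w : I → HeightOneSpectrum (𝓞 K))
  (hw : ∀ i, ((p : ℕ) : 𝓞 K) ∈ (w i).asIdeal)

/-- **A FACTORWISE print-(Ind2) family is a unit homothety.** Let `X = ⊗_{ℚ_p, i} K_{w_i}` be the tensor packet of the
GENUINE completions (abc-iut-S7's rescaled completions `K_{w_i}^{(1/n)}`, the factors of this lineage's genuine real packets),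
and let `g` be a `ℚ_p`-linear automorphism of `X` acting on pure tensors through «independent copies of Ism … on each of the
direct summands of the j+1 factors» ([IUTchIII] Thm. 3.11 (i) (Ind2), p. 154): `g(⊗_i x_i) = ⊗_i ψ_i(x_i)` with every `ψ_i` in
PRINT's (Ind2)-group at `w_i` as typed by abc-iut-c312-1 — `Real.ismIsm (analyticLogv K) (w i)`, the bicontinuous automorphisms
of `K_{w_i}` realising a `G_{w_i}`-isometry of [IUTchII] Ex. 1.8 (iv) through the (analytic = Galois) logarithm. THEN `g = u·id`
for ONE `u ∈ ℚ_p` with `‖u‖ = 1`: each `ψ_i` is a unit scalar `c_i` (abc-iut-w5-d216 `ismIsm_analyticLogv_eq_unitScalars`,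
p452975, resting on c312-1's norm rigidity and the tree's discharged local existence theorem), and `⊗_i c_i = (Π_i c_i)·id`.
[cite: Mochizuki2012, IUTchIII Thm. 3.11 (i) p. 154] [cite: Mochizuki2012, IUTchII Ex. 1.8 (iv) p. 39]
[claim: Mochizuki2012, status: disputed] -/
theorem exists_unit_smul_of_printInd2
    (ψ : ∀ i, Carrier (.inr (w i) : Thm311.Real.Place K) ≃ₗ[ℚ] Carrier (.inr (w i) : Thm311.Real.Place K))
    (hψ : ∀ i, ψ i ∈ ismIsm (analyticLogv K) (w i))
    (g : PacketAlgebra p (fun i => RescaledCompletion K p (w i) (hw i)) ≃ₗ[ℚ_[p]]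
      PacketAlgebra p (fun i => RescaledCompletion K p (w i) (hw i)))
    (hg : ∀ x : Π i, RescaledCompletion K p (w i) (hw i),
      g (PiTensorProduct.tprod ℚ_[p] x) =
        PiTensorProduct.tprod ℚ_[p] (fun i =>
          RescaledCompletion.of K p (w i) (hw i) (ψ i ((RescaledCompletion.of K p (w i) (hw i)).symm (x i))))) :
    ∃ u : ℚ_[p], ‖u‖ = 1 ∧ ∀ y, g y = u • y := by
  -- each factor map is a unit scalar (w5-d216 / c312-1, by name)
  have hc : ∀ i, ∃ c : ℚ_[p], ‖c‖ = 1 ∧ ∀ a : Carrier (.inr (w i) : Thm311.Real.Place K),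
      RescaledCompletion.of K p (w i) (hw i) (ψ i a) = c • RescaledCompletion.of K p (w i) (hw i) a :=
    fun i => (mem_ismIsm_analyticLogv_iff_exists_unit_scalar (w i) p (hw i) (ψ i)).mp (hψ i)
  choose c hc1 hc using hc
  refine exists_unit_smul_of_map_tprod p (fun i => RescaledCompletion K p (w i) (hw i)) g c hc1 fun x => ?_
  rw [hg x]
  congr 1
  funext i
  rw [hc i, RingEquiv.apply_symm_apply]

/-- **Exactness (non-vacuity): EVERY unit homothety of the genuine packet arises from a factorwise print-(Ind2) family.**
For `u ∈ ℚ_p`, `‖u‖ = 1`, and a chosen factor `i₀`, the family `ψ_{i₀} := u·(−)` (an element of print's (Ind2)-group at `w_{i₀}`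
by abc-iut-w5-d216's `mem_ismIsm_analyticLogv_iff_exists_unit_scalar`, i.e. c312-1's `Ẑ^×` non-vacuity with `Ẑ^× ↠ ℤ_p^×`),
`ψ_i := id` (`i ≠ i₀`), acts on pure tensors as `u·id`.  So on a genuine tensor packet PRINT's factorwise (Ind2) — as typed —
is EXACTLY the group of unit homotheties `ℤ_p^×·id` (this seat's `smulOfUnit_mem_indTwo`: inside the Dupuy–Hilado container).
[cite: Mochizuki2012, IUTchII Ex. 1.8 (iv) p. 39] [claim: Mochizuki2012, status: disputed] -/
theorem exists_printInd2_of_unit (i₀ : I) {u : ℚ_[p]} (hu : ‖u‖ = 1) :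
    ∃ ψ : ∀ i, Carrier (.inr (w i) : Thm311.Real.Place K) ≃ₗ[ℚ] Carrier (.inr (w i) : Thm311.Real.Place K),
      (∀ i, ψ i ∈ ismIsm (analyticLogv K) (w i)) ∧
      ∀ x : Π i, RescaledCompletion K p (w i) (hw i),
        PiTensorProduct.tprod ℚ_[p] (fun i =>
          RescaledCompletion.of K p (w i) (hw i) (ψ i ((RescaledCompletion.of K p (w i) (hw i)).symm (x i)))) =
        u • PiTensorProduct.tprod ℚ_[p] x := by
  classical
  have hu0 : u ≠ 0 := norm_ne_zero_iff.mp (by rw [hu]; exact one_ne_zero)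
  -- the scalar `u` read in `K_{w_i}` and multiplication by it, as a `ℚ`-linear automorphism of the carrier
  let s : ∀ i, RescaledCompletion K p (w i) (hw i) := fun i => algebraMap ℚ_[p] _ u
  have hs0 : ∀ i, s i ≠ 0 := fun i => by
    simp only [s, ne_eq, map_eq_zero]; exact hu0
  let mulS : ∀ i, Carrier (.inr (w i) : Thm311.Real.Place K) ≃+ Carrier (.inr (w i) : Thm311.Real.Place K) := fun i =>
    ((RescaledCompletion.of K p (w i) (hw i)).toAddEquiv.trans
      (AddAut.mulLeft (Units.mk0 (s i) (hs0 i)))).trans (RescaledCompletion.of K p (w i) (hw i)).symm.toAddEquiv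
  have hmulS : ∀ i (a : Carrier (.inr (w i) : Thm311.Real.Place K)),
      RescaledCompletion.of K p (w i) (hw i) (mulS i a) = u • RescaledCompletion.of K p (w i) (hw i) a := by
    intro i a
    change RescaledCompletion.of K p (w i) (hw i) ((RescaledCompletion.of K p (w i) (hw i)).symm
      (s i * RescaledCompletion.of K p (w i) (hw i) a)) = _
    rw [RingEquiv.apply_symm_apply, Algebra.smul_def]
  let ψ : ∀ i, Carrier (.inr (w i) : Thm311.Real.Place K) ≃ₗ[ℚ] Carrier (.inr (w i) : Thm311.Real.Place K) := fun i =>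
    if i = i₀ then (mulS i).toLinearEquiv (fun c x => map_rat_smul (mulS i) c x) else LinearEquiv.refl ℚ _
  have hψ₀ : ∀ a, ψ i₀ a = mulS i₀ a := fun a => by simp [ψ]
  have hψ' : ∀ i, i ≠ i₀ → ∀ a, ψ i a = a := fun i hi a => by simp [ψ, hi]
  refine ⟨ψ, fun i => ?_, fun x => ?_⟩
  · by_cases hi : i = i₀
    · subst hi
      refine (mem_ismIsm_analyticLogv_iff_exists_unit_scalar (w i) p (hw i) (ψ i)).mpr ⟨u, hu, fun a => ?_⟩
      rw [hψ₀, hmulS]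
    · have : ψ i = LinearEquiv.refl ℚ _ := by simp [ψ, hi]
      rw [this]
      exact refl_mem_ismIsm (analyticLogv K) (w i)
  · have hfac : (fun i => RescaledCompletion.of K p (w i) (hw i)
        (ψ i ((RescaledCompletion.of K p (w i) (hw i)).symm (x i)))) =
        fun i => (if i = i₀ then u else 1) • x i := by
      funext i
      by_cases hi : i = i₀
      · subst hi
        rw [hψ₀, hmulS, RingEquiv.apply_symm_apply, if_pos rfl]
      · rw [hψ' i hi, RingEquiv.apply_symm_apply, if_neg hi, one_smul]
    rw [hfac, (PiTensorProduct.tprod ℚ_[p]).map_smul_univ (fun i => if i = i₀ then u else 1) x]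
    congr 1
    rw [Finset.prod_ite_eq' Finset.univ i₀ (fun _ => u)]
    simp

end PrintFactors

/-! ## 3. The GENUINE real packet of a place section: reading (P) over PRINT's (Ind2) is the BARE value -/

section GenuinePacket

variable {F₀ : Type} [Field F₀] [NumberField F₀] {K : Type} [Field K] [NumberField K] [Algebra F₀ K]
variable (σ : PlaceSection F₀ K) (p : ℕ) [hp : Fact p.Prime]
variable (c : (j : ℕ) → (Fin (j + 1) → placesOver F₀ p) → ℚ_[p]) (hc0 : ∀ j e, c j e ≠ 0)
  (hcσ : ∀ (j : ℕ) (τ : Equiv.Perm (Fin (j + 1))) (e : Fin (j + 1) → placesOver F₀ p), c j (e ∘ τ) = c j e)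

/-- **On the genuine packet `X_{v⃗} = ⊗_b K_{v̲_b}` of a place section, every element of a family of subgroups DOMINATED BY
PRINT's (Ind2)** — each `g ∈ H_{v⃗}` acts on pure tensors factorwise through elements of c312-1's `Real.ismIsm (analyticLogv K) v̲_b`
([IUTchIII] Thm. 3.11 (i) (Ind2) «independent copies of Ism … on each of the direct summands») — **is a unit homothety**: the
hypothesis `hH` of this lineage's `…_eq_of_forall_eq_smul` theorems (p503117 / p503854) HOLDS for print's (Ind2) as typed.
[cite: Mochizuki2012, IUTchIII Thm. 3.11 (i) p. 154] [claim: Mochizuki2012, status: disputed] -/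
theorem forall_exists_unit_smul_of_printInd2
    (H : (j : ℕ) → (e : Fin (j + 1) → placesOver F₀ p) →
      Subgroup (PacketAlgebra p (fun b => (σ.localFields p).k (e b)) ≃ₗ[ℚ_[p]]
        PacketAlgebra p (fun b => (σ.localFields p).k (e b))))
    (hH : ∀ j e, ∀ g ∈ H j e,
      ∃ ψ : ∀ b : Fin (j + 1), Carrier (.inr (σ.lift (e b).1) : Thm311.Real.Place K) ≃ₗ[ℚ]
          Carrier (.inr (σ.lift (e b).1) : Thm311.Real.Place K),
        (∀ b, ψ b ∈ ismIsm (analyticLogv K) (σ.lift (e b).1)) ∧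
        ∀ x : ∀ b, (σ.localFields p).k (e b),
          (g : PacketAlgebra p (fun b => (σ.localFields p).k (e b)) ≃ₗ[ℚ_[p]]
              PacketAlgebra p (fun b => (σ.localFields p).k (e b))) (PiTensorProduct.tprod ℚ_[p] x) =
            PiTensorProduct.tprod ℚ_[p] (fun b =>
              RescaledCompletion.of K p (σ.lift (e b).1) (σ.natCast_mem_lift (e b))
                (ψ b ((RescaledCompletion.of K p (σ.lift (e b).1) (σ.natCast_mem_lift (e b))).symm (x b))))) :
    ∀ j e, ∀ g ∈ H j e, ∃ u : ℚ_[p], ‖u‖ = 1 ∧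
      ∀ x, (g : PacketAlgebra p (fun b => (σ.localFields p).k (e b)) ≃ₗ[ℚ_[p]]
        PacketAlgebra p (fun b => (σ.localFields p).k (e b))) x = u • x := by
  intro j e g hg
  obtain ⟨ψ, hψ, hgψ⟩ := hH j e g hg
  exact exists_unit_smul_of_printInd2 p (fun b => σ.lift (e b).1) (fun b => σ.natCast_mem_lift (e b)) ψ hψ g hgψ

/-- **READING (P) OVER PRINT's (Ind2) IS THE BARE VALUE.** For the real packet of the GENUINE completions of a place section
(any shell normalisation `c`), a `p`-local Θ-idele `t`, and any family `H` of subgroups of the packet automorphisms dominated by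
print's (Ind2) (factorwise `Real.ismIsm`): `ln ν̄_{𝕃_p}` of `v⃗ ↦ hull(⋃_{g ∈ H_{v⃗}} g(O_𝕃(−P_Θ)_{v⃗}))` EQUALS the bare
`ln ν̄_{𝕃_p}(O_𝕃(−P_Θ)_p)` — ZERO (Ind2)-gain (this lineage's `realPrimePacketWith_lnνLp_hull_orbitH_eq_of_forall_eq_smul`, p503117,
fed with §2). [cite: DupuyHilado2025, §4.9, §4.12, Thm. 3.10.1] [cite: Mochizuki2012, IUTchIII Cor. 3.12 proof Step (x) p. 181]
[claim: Mochizuki2012, status: disputed] -/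
theorem localFields_lnνLp_hull_printInd2_eq_pilotRegion {lstar : ℕ}
    (t : Fin lstar → (v : placesOver F₀ p) → ((σ.localFields p).k v)ˣ)
    (H : (j : ℕ) → (e : Fin (j + 1) → placesOver F₀ p) →
      Subgroup (PacketAlgebra p (fun b => (σ.localFields p).k (e b)) ≃ₗ[ℚ_[p]]
        PacketAlgebra p (fun b => (σ.localFields p).k (e b))))
    (hH : ∀ j e, ∀ g ∈ H j e,
      ∃ ψ : ∀ b : Fin (j + 1), Carrier (.inr (σ.lift (e b).1) : Thm311.Real.Place K) ≃ₗ[ℚ]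
          Carrier (.inr (σ.lift (e b).1) : Thm311.Real.Place K),
        (∀ b, ψ b ∈ ismIsm (analyticLogv K) (σ.lift (e b).1)) ∧
        ∀ x : ∀ b, (σ.localFields p).k (e b),
          (g : PacketAlgebra p (fun b => (σ.localFields p).k (e b)) ≃ₗ[ℚ_[p]]
              PacketAlgebra p (fun b => (σ.localFields p).k (e b))) (PiTensorProduct.tprod ℚ_[p] x) =
            PiTensorProduct.tprod ℚ_[p] (fun b =>
              RescaledCompletion.of K p (σ.lift (e b).1) (σ.natCast_mem_lift (e b))
                (ψ b ((RescaledCompletion.of K p (σ.lift (e b).1) (σ.natCast_mem_lift (e b))).symm (x b))))) :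
    (realPrimePacketWith p (σ.localFields p) c hc0 hcσ).lnνLp lstar (fun j e =>
        packetHull p (fun b => (σ.localFields p).k (e b))
          (⋃ g : H j e, (g : PacketAlgebra p (fun b => (σ.localFields p).k (e b)) ≃ₗ[ℚ_[p]]
              PacketAlgebra p (fun b => (σ.localFields p).k (e b))) ''
            (realPrimePacketWith p (σ.localFields p) c hc0 hcσ).pilotRegion t j e)) =
      (realPrimePacketWith p (σ.localFields p) c hc0 hcσ).lnνLp lstar
        ((realPrimePacketWith p (σ.localFields p) c hc0 hcσ).pilotRegion t) :=
  realPrimePacketWith_lnνLp_hull_orbitH_eq_of_forall_eq_smul p (σ.localFields p) c hc0 hcσ t H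
    (forall_exists_unit_smul_of_printInd2 σ p H hH)

/-- **READING (U) OVER PRINT's (Ind2) IS THE PURE (Ind1)-VALUE.** Same packet, same hypotheses: `ln ν̄_{𝕃_p}` of
`v⃗ ↦ hull(⋃_{g ∈ H_{v⃗}} g(⋃_σ σ·O_𝕃(−P_Θ)))` (the (U)-region with (Ind2) restricted to print's factorwise `Ism`) EQUALS `ln ν̄_{𝕃_p}` of the
hulls of the (Ind1)-slot unions alone — ZERO (Ind2)-gain in reading (U) too (this lineage's
`realPrimePacketWith_lnνLp_hull_orbitH_slotUnion_eq_of_forall_eq_smul`, p503854, fed with §2; what remains of the (U)-gain is abc-iut-s2-p2's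
slot residue, `0` at slot-constant data). [cite: DupuyHilado2025, §4.7, §4.9, §4.11–4.12] [cite: Mochizuki2012, IUTchIII Cor. 3.12 p. 174]
[claim: Mochizuki2012, status: disputed] -/
theorem localFields_lnνLp_hull_printInd2_slotUnion_eq {lstar : ℕ}
    (t : Fin lstar → (v : placesOver F₀ p) → ((σ.localFields p).k v)ˣ)
    (H : (j : ℕ) → (e : Fin (j + 1) → placesOver F₀ p) →
      Subgroup (PacketAlgebra p (fun b => (σ.localFields p).k (e b)) ≃ₗ[ℚ_[p]]
        PacketAlgebra p (fun b => (σ.localFields p).k (e b))))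
    (hH : ∀ j e, ∀ g ∈ H j e,
      ∃ ψ : ∀ b : Fin (j + 1), Carrier (.inr (σ.lift (e b).1) : Thm311.Real.Place K) ≃ₗ[ℚ]
          Carrier (.inr (σ.lift (e b).1) : Thm311.Real.Place K),
        (∀ b, ψ b ∈ ismIsm (analyticLogv K) (σ.lift (e b).1)) ∧
        ∀ x : ∀ b, (σ.localFields p).k (e b),
          (g : PacketAlgebra p (fun b => (σ.localFields p).k (e b)) ≃ₗ[ℚ_[p]]
              PacketAlgebra p (fun b => (σ.localFields p).k (e b))) (PiTensorProduct.tprod ℚ_[p] x) =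
            PiTensorProduct.tprod ℚ_[p] (fun b =>
              RescaledCompletion.of K p (σ.lift (e b).1) (σ.natCast_mem_lift (e b))
                (ψ b ((RescaledCompletion.of K p (σ.lift (e b).1) (σ.natCast_mem_lift (e b))).symm (x b))))) :
    (realPrimePacketWith p (σ.localFields p) c hc0 hcσ).lnνLp lstar (fun j e =>
        packetHull p (fun b => (σ.localFields p).k (e b))
          (⋃ g : H j e, (g : PacketAlgebra p (fun b => (σ.localFields p).k (e b)) ≃ₗ[ℚ_[p]]
              PacketAlgebra p (fun b => (σ.localFields p).k (e b))) ''
            ⋃ τ : Equiv.Perm (Fin (j + 1)), (realPrimePacketWith p (σ.localFields p) c hc0 hcσ).perm τ e ''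
              (realPrimePacketWith p (σ.localFields p) c hc0 hcσ).pilotRegion t j (e ∘ τ))) =
      (realPrimePacketWith p (σ.localFields p) c hc0 hcσ).lnνLp lstar (fun j e =>
        packetHull p (fun b => (σ.localFields p).k (e b))
          (⋃ τ : Equiv.Perm (Fin (j + 1)), (realPrimePacketWith p (σ.localFields p) c hc0 hcσ).perm τ e ''
            (realPrimePacketWith p (σ.localFields p) c hc0 hcσ).pilotRegion t j (e ∘ τ))) :=
  realPrimePacketWith_lnνLp_hull_orbitH_slotUnion_eq_of_forall_eq_smul p (σ.localFields p) c hc0 hcσ t H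
    (forall_exists_unit_smul_of_printInd2 σ p H hH)

end GenuinePacket

end Summit.ABC.IUTFork

end
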